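import Summits.ResolutionOfSingularities.ResolutionOfSingularities.Theorems.FrobeniusLadderFRationalResolutionCompletedBaseChangeFibreStalks
import Literature.AlgebraicGeometry.Resolution.AffineBlowupReductionCover
import HarnessLib

/-!
# Crux `FrobeniusLadder.FRationalResolution` (stmt-ResolutionOfSingularities-15317), line `redirect`,
# stub `stub_diagonalizableQuotientResolution` — THE CHART FACTS OF THE NAIVE TWO-STEP RECIPE NEED ONLY BE CHECKED ON THE CHARTS
# OF A REDUCTION (for a monomial centre: the vertex charts of its Newton polyhedron)

The two-step consumers (`…EtaleChartTwoStepModelScheme`, `…FixedPointTwoStepModel(Isolated)`) ask for the two chart facts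
— `hfinm`: finitely many non-regular primes over `𝔳` of `T[J/xᵢ]`; `hmodel`: the point blow-up of `T[J/xᵢ]_𝔫` is regular at
each of them — on EVERY chart of a generating family `x` of the centre `J`. Since the charts `D₊(yⱼ t)` at a REDUCTION `y` of `J`
(`J^{N+1} ⊆ (y) J^N`) already cover `Bl_J(Spec T)` (Literature `affineBlowup.iSup_basicOpen_reesT_eq_top_of_pow_le`), and the
local ring of a chart ring at a prime is the local ring of the blow-up at the corresponding point, the chart facts on the
`y`-charts imply the chart facts on the chart of ANY `x ∈ J`. For a monomial ideal of a toric ring the monomials at the vertices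
of the Newton polyhedron generate a reduction, so a per-class verification runs over the vertex charts only.

* §1 the canonical map `𝔫 ↦ awayι(𝔫)` from the primes of a chart ring `T[J/x]` to the points of `Bl_J(Spec T)`: base point,
  local ring (`≅ T[J/x]_𝔫`), regularity, injectivity; every point of `D₊(x t)` is hit (`exists_chartPoint_eq_of_mem_basicOpen`),
  every point is hit from a reduction chart (`exists_chartPoint_eq_of_pow_le`).
* §2 ★★ `finite_nonRegular_over_of_reduction`, ★★ `isRegular_pointBlowup_of_reduction` — each chart fact transfers;
* §3 ★★★ `chartFacts_of_reduction` — both chart facts for all charts of any family `x ⊆ J` from the charts of a reduction `y`,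
  in the exact shape of the consumers' hypotheses `hfinm` / `hmodel`.

Honest label: scheme plumbing toward ONE leaf stub (no stub, crux or summit closed). No definitions, no named facts, no sorry.
[cite: GortzWedhorn2020, (13.19) p. 415] [cite: StacksProject, Tag 0804; Tag 01I0]
-/

noncomputable section

-- single-problem summit: the doubled namespace component is forced
set_option linter.dupNamespace false

open CategoryTheory AlgebraicGeometry TopologicalSpace IsLocalRing
open Literature.AlgebraicGeometry.Resolution

namespace Summit.ResolutionOfSingularities.ResolutionOfSingularities.Theorems.FRationalResolution.ChartFactsOfReduction

variable {R : Type} [CommRing R] (I : Ideal R)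

/-- The point of `Bl_I(Spec R)` on the chart `D₊(x t)` attached to a prime `𝔫` of the chart ring `R[I/x]` (through
`reesChartEquiv : (R[It])_{(xt)} ≅ R[I/x]` and the open immersion `awayι`). -/
local notation3 (prettyPrint := false) "PT[" I ", " x ", " hx ", " 𝔫 "]" =>
  Proj.awayι (reesGrading I) (reesT x hx) (reesT_mem x hx) one_pos
    (PrimeSpectrum.comap (reesChartEquiv (I := I) x hx).toRingHom 𝔫)

/-! ## §1 The chart-prime ↦ point dictionary -/

/-- The membership dictionary between the prime of `(R[It])_{(xt)}` and the prime `𝔫` of `R[I/x]`. [folklore] -/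
theorem mem_comap_reesChartEquiv_iff (x : R) (hx : x ∈ I) (𝔫 : PrimeSpectrum (blowupAlgebra I x)) :
    ∀ s, s ∈ (PrimeSpectrum.comap (reesChartEquiv (I := I) x hx).toRingHom 𝔫).asIdeal ↔
      reesChartEquiv (I := I) x hx s ∈ 𝔫.asIdeal := fun _ => Iff.rfl

/-- The chart point lies in the chart `D₊(x t)`. [cite: StacksProject, Tag 0804] -/
theorem chartPoint_mem_basicOpen (x : R) (hx : x ∈ I) (𝔫 : PrimeSpectrum (blowupAlgebra I x)) :
    PT[I, x, hx, 𝔫] ∈ Proj.basicOpen (reesGrading I) (reesT x hx) := by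
  have h : PT[I, x, hx, 𝔫] ∈ (Proj.awayι (reesGrading I) (reesT x hx) (reesT_mem x hx) one_pos).opensRange := ⟨_, rfl⟩
  rwa [Proj.opensRange_awayι] at h

/-- **The base point of the chart point is `𝔫 ∩ R`.** [cite: StacksProject, Tag 0804] -/
theorem π_chartPoint (x : R) (hx : x ∈ I) (𝔫 : PrimeSpectrum (blowupAlgebra I x)) :
    (affineBlowup.π I PT[I, x, hx, 𝔫]).asIdeal = 𝔫.asIdeal.comap (algebraMap R (blowupAlgebra I x)) := by
  have h1 : affineBlowup.π I PT[I, x, hx, 𝔫] = Spec.map (CommRingCat.ofHom (reesChartBase x hx))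
      (PrimeSpectrum.comap (reesChartEquiv (I := I) x hx).toRingHom 𝔫) := by
    rw [← Scheme.Hom.comp_apply, affineBlowup.awayι_reesT_π]
  rw [h1]
  ext r
  rw [Ideal.mem_comap]
  change reesChartBase x hx r ∈ (PrimeSpectrum.comap (reesChartEquiv (I := I) x hx).toRingHom 𝔫).asIdeal ↔ _
  rw [mem_comap_reesChartEquiv_iff, reesChartEquiv_reesChartBase]

/-- **The local ring of `Bl_I(Spec R)` at the chart point is `R[I/x]_𝔫`.** [cite: StacksProject, Tag 0804; Tag 01I0] -/
theorem nonempty_ringEquiv_stalk_chartPoint (x : R) (hx : x ∈ I) (𝔫 : PrimeSpectrum (blowupAlgebra I x)) :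
    Nonempty ((affineBlowup I).presheaf.stalk PT[I, x, hx, 𝔫] ≃+* Localization.AtPrime 𝔫.asIdeal) :=
  CompletedBaseChangeFibreStalks.nonempty_ringEquiv_stalk_awayι I x hx _ 𝔫.asIdeal (mem_comap_reesChartEquiv_iff I x hx 𝔫)

/-- Regularity of the blow-up at the chart point is regularity of `R[I/x]_𝔫`. [cite: StacksProject, Tag 0804] -/
theorem isRegularLocalRing_stalk_chartPoint_iff (x : R) (hx : x ∈ I) (𝔫 : PrimeSpectrum (blowupAlgebra I x)) :
    IsRegularLocalRing ((affineBlowup I).presheaf.stalk PT[I, x, hx, 𝔫]) ↔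
      IsRegularLocalRing (Localization.AtPrime 𝔫.asIdeal) := by
  obtain ⟨e⟩ := nonempty_ringEquiv_stalk_chartPoint I x hx 𝔫
  exact ⟨fun h => IsRegularLocalRing.of_ringEquiv e,
    fun h => IsRegularLocalRing.of_ringEquiv (R := Localization.AtPrime 𝔫.asIdeal) e.symm⟩

/-- The chart-prime ↦ point map is injective. [folklore] -/
theorem chartPoint_injective (x : R) (hx : x ∈ I) :
    Function.Injective fun 𝔫 : PrimeSpectrum (blowupAlgebra I x) => PT[I, x, hx, 𝔫] := by
  intro 𝔫 𝔫' h
  have h1 := (Proj.awayι (reesGrading I) (reesT x hx) (reesT_mem x hx) one_pos).isOpenEmbedding.injective h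
  exact PrimeSpectrum.comap_injective_of_surjective _ (reesChartEquiv (I := I) x hx).surjective h1

/-- **Every point of the chart `D₊(x t)` is a chart point.** [cite: StacksProject, Tag 0804] -/
theorem exists_chartPoint_eq_of_mem_basicOpen (x : R) (hx : x ∈ I) (p : affineBlowup I)
    (hp : p ∈ Proj.basicOpen (reesGrading I) (reesT x hx)) :
    ∃ 𝔫 : PrimeSpectrum (blowupAlgebra I x), PT[I, x, hx, 𝔫] = p := by
  have hrange : p ∈ (Proj.awayι (reesGrading I) (reesT x hx) (reesT_mem x hx) one_pos).opensRange := by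
    rw [Proj.opensRange_awayι]; exact hp
  obtain ⟨q, hq⟩ := hrange
  refine ⟨PrimeSpectrum.comap (reesChartEquiv (I := I) x hx).symm.toRingHom q, ?_⟩
  have hqq : PrimeSpectrum.comap (reesChartEquiv (I := I) x hx).toRingHom
      (PrimeSpectrum.comap (reesChartEquiv (I := I) x hx).symm.toRingHom q) = q := by
    ext s
    change (reesChartEquiv (I := I) x hx).symm (reesChartEquiv (I := I) x hx s) ∈ q.asIdeal ↔ s ∈ q.asIdeal
    rw [RingEquiv.symm_apply_apply]
  rw [hqq]
  exact hq

/-- **Every point of `Bl_I(Spec R)` is a chart point of a REDUCTION chart**: for `yⱼ ∈ I` with `I^{N+1} ⊆ (y) I^N` the charts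
`D₊(yⱼ t)` cover the blow-up. [cite: GortzWedhorn2020, (13.19) p. 415] -/
theorem exists_chartPoint_eq_of_pow_le {ι : Type*} (y : ι → R) (hyI : ∀ j, y j ∈ I) {N : ℕ}
    (hred : I ^ (N + 1) ≤ Ideal.span (Set.range y) * I ^ N) (p : affineBlowup I) :
    ∃ (j : ι) (𝔫 : PrimeSpectrum (blowupAlgebra I (y j))), PT[I, y j, hyI j, 𝔫] = p := by
  have hp : p ∈ ⨆ j, Proj.basicOpen (reesGrading I) (reesT (y j) (hyI j)) := by
    rw [affineBlowup.iSup_basicOpen_reesT_eq_top_of_pow_le y hyI hred]; trivial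
  obtain ⟨j, hj⟩ := Opens.mem_iSup.mp hp
  obtain ⟨𝔫, h𝔫⟩ := exists_chartPoint_eq_of_mem_basicOpen I (y j) (hyI j) p hj
  exact ⟨j, 𝔫, h𝔫⟩

/-! ## §2 Transfer of the chart facts from the charts of a reduction -/

/-- ★★ **FINITELY MANY NON-REGULAR POINTS OVER `V(𝔳)` from the reduction charts**, and hence finitely many non-regular primes
over `𝔳` on the chart of ANY `x ∈ I`. [cite: GortzWedhorn2020, (13.19) p. 415] [cite: StacksProject, Tag 0804] -/
theorem finite_nonRegular_over_of_reduction (𝔳 : Ideal R) {ι : Type*} [Finite ι] (y : ι → R) (hyI : ∀ j, y j ∈ I) {N : ℕ}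
    (hred : I ^ (N + 1) ≤ Ideal.span (Set.range y) * I ^ N)
    (hfinm : ∀ j, {𝔫 : PrimeSpectrum (blowupAlgebra I (y j)) |
      𝔳.map (algebraMap R (blowupAlgebra I (y j))) ≤ 𝔫.asIdeal ∧
        ¬ IsRegularLocalRing (Localization.AtPrime 𝔫.asIdeal)}.Finite)
    (x : R) (hx : x ∈ I) :
    {𝔫 : PrimeSpectrum (blowupAlgebra I x) |
      𝔳.map (algebraMap R (blowupAlgebra I x)) ≤ 𝔫.asIdeal ∧ ¬ IsRegularLocalRing (Localization.AtPrime 𝔫.asIdeal)}.Finite := by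
  -- the non-regular points of the blow-up over `V(𝔳)` are finitely many
  have hS : {p : affineBlowup I | 𝔳 ≤ (affineBlowup.π I p).asIdeal ∧
      ¬ IsRegularLocalRing ((affineBlowup I).presheaf.stalk p)}.Finite := by
    refine ((Set.finite_iUnion fun j => (hfinm j).image fun 𝔫 => PT[I, y j, hyI j, 𝔫])).subset ?_
    rintro p ⟨hp𝔳, hp⟩
    obtain ⟨j, 𝔫, rfl⟩ := exists_chartPoint_eq_of_pow_le I y hyI hred p
    refine Set.mem_iUnion.mpr ⟨j, 𝔫, ⟨?_, ?_⟩, rfl⟩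
    · rw [Ideal.map_le_iff_le_comap, ← π_chartPoint I (y j) (hyI j) 𝔫]
      exact hp𝔳
    · rwa [← isRegularLocalRing_stalk_chartPoint_iff]
  refine Set.Finite.of_finite_image (hS.subset ?_) (chartPoint_injective I x hx).injOn
  rintro _ ⟨𝔫, ⟨h𝔫𝔳, h𝔫⟩, rfl⟩
  refine ⟨?_, ?_⟩
  · rw [π_chartPoint, ← Ideal.map_le_iff_le_comap]
    exact h𝔫𝔳
  · rwa [isRegularLocalRing_stalk_chartPoint_iff]

/-- ★★ **REGULAR POINT BLOW-UP at a non-regular prime over `𝔳` of the chart of ANY `x ∈ I`, from the reduction charts** (the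
local rings `R[I/x]_𝔫 ≅ 𝒪_{Bl, p} ≅ R[I/yⱼ]_{𝔫'}` agree). [cite: GortzWedhorn2020, (13.19) p. 415] [cite: StacksProject, Tag 0804; Tag 01I0] -/
theorem isRegular_pointBlowup_of_reduction (𝔳 : Ideal R) {ι : Type*} (y : ι → R) (hyI : ∀ j, y j ∈ I) {N : ℕ}
    (hred : I ^ (N + 1) ≤ Ideal.span (Set.range y) * I ^ N)
    (hmodel : ∀ (j : ι) (𝔫 : PrimeSpectrum (blowupAlgebra I (y j))),
      𝔳.map (algebraMap R (blowupAlgebra I (y j))) ≤ 𝔫.asIdeal →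
      ¬ IsRegularLocalRing (Localization.AtPrime 𝔫.asIdeal) →
      Scheme.IsRegular (affineBlowup (R := Localization.AtPrime 𝔫.asIdeal)
        (maximalIdeal (Localization.AtPrime 𝔫.asIdeal))))
    (x : R) (hx : x ∈ I) (𝔫 : PrimeSpectrum (blowupAlgebra I x))
    (h𝔫𝔳 : 𝔳.map (algebraMap R (blowupAlgebra I x)) ≤ 𝔫.asIdeal)
    (h𝔫 : ¬ IsRegularLocalRing (Localization.AtPrime 𝔫.asIdeal)) :
    Scheme.IsRegular (affineBlowup (R := Localization.AtPrime 𝔫.asIdeal)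
      (maximalIdeal (Localization.AtPrime 𝔫.asIdeal))) := by
  obtain ⟨j, 𝔫', h𝔫'⟩ := exists_chartPoint_eq_of_pow_le I y hyI hred PT[I, x, hx, 𝔫]
  -- the local rings `R[I/yⱼ]_{𝔫'} ≅ 𝒪_{Bl, p'} = 𝒪_{Bl, p} ≅ R[I/x]_𝔫`
  obtain ⟨e'⟩ := nonempty_ringEquiv_stalk_chartPoint I (y j) (hyI j) 𝔫'
  obtain ⟨e⟩ := nonempty_ringEquiv_stalk_chartPoint I x hx 𝔫
  let est : (affineBlowup I).presheaf.stalk PT[I, y j, hyI j, 𝔫'] ≃+* (affineBlowup I).presheaf.stalk PT[I, x, hx, 𝔫] :=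
    ((affineBlowup I).presheaf.stalkCongr (Inseparable.of_eq h𝔫')).commRingCatIsoToRingEquiv
  let E : Localization.AtPrime 𝔫'.asIdeal ≃+* Localization.AtPrime 𝔫.asIdeal := e'.symm.trans (est.trans e)
  -- the reduction-chart prime lies over `𝔳` and is non-regular
  have hπ : (affineBlowup.π I PT[I, y j, hyI j, 𝔫']).asIdeal = 𝔫.asIdeal.comap (algebraMap R (blowupAlgebra I x)) := by
    rw [h𝔫', π_chartPoint]
  have h1 : 𝔳.map (algebraMap R (blowupAlgebra I (y j))) ≤ 𝔫'.asIdeal := by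
    rw [Ideal.map_le_iff_le_comap, ← π_chartPoint I (y j) (hyI j) 𝔫', hπ, ← Ideal.map_le_iff_le_comap]
    exact h𝔫𝔳
  have h2 : ¬ IsRegularLocalRing (Localization.AtPrime 𝔫'.asIdeal) := fun h =>
    h𝔫 (IsRegularLocalRing.of_ringEquiv (R := Localization.AtPrime 𝔫'.asIdeal) E)
  -- transport the regular point blow-up along `E`
  exact CompletedBaseChangeFibrePoints.isRegular_affineBlowup_maximalIdeal_of_ringEquiv
    (R := Localization.AtPrime 𝔫'.asIdeal) (S := Localization.AtPrime 𝔫.asIdeal) E (hmodel j 𝔫' h1 h2)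

/-! ## §3 In the shape of the consumers' hypotheses -/

/-- ★★★ **THE CHART FACTS ON ALL CHARTS FROM THE CHARTS OF A REDUCTION.** `T` Noetherian, `𝔳, J ⊆ T` ideals, `x : Fin n → T`
any elements of `J` (e.g. a generating family, as the consumers require), `y : Fin m → T` elements of `J` generating a
reduction: `J^{N+1} ⊆ (y) J^N`. If the chart rings `T[J/yⱼ]` have finitely many non-regular primes over `𝔳`, at each of
which the point blow-up is regular, then the same holds for the chart rings `T[J/xᵢ]` — the hypotheses `hfinm` / `hmodel`
of `…EtaleChartTwoStepModelScheme.hloc_of_model_charts_etale_nhd` and `…FixedPointTwoStepModel…`.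
[cite: GortzWedhorn2020, (13.19) p. 415] [cite: StacksProject, Tag 0804; Tag 01I0] -/
theorem chartFacts_of_reduction {T : Type} [CommRing T] (𝔳 J : Ideal T) {n : ℕ} (x : Fin n → T) (hxJ : ∀ i, x i ∈ J)
    {m : ℕ} (y : Fin m → T) (hyJ : ∀ j, y j ∈ J) {N : ℕ} (hred : J ^ (N + 1) ≤ Ideal.span (Set.range y) * J ^ N)
    (hfinm : ∀ j : Fin m, {𝔫 : PrimeSpectrum (blowupAlgebra J (y j)) |
      𝔳.map (algebraMap T (blowupAlgebra J (y j))) ≤ 𝔫.asIdeal ∧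
        ¬ IsRegularLocalRing (Localization.AtPrime 𝔫.asIdeal)}.Finite)
    (hmodel : ∀ (j : Fin m) (𝔫 : PrimeSpectrum (blowupAlgebra J (y j))),
      𝔳.map (algebraMap T (blowupAlgebra J (y j))) ≤ 𝔫.asIdeal →
      ¬ IsRegularLocalRing (Localization.AtPrime 𝔫.asIdeal) →
      Scheme.IsRegular (affineBlowup (R := Localization.AtPrime 𝔫.asIdeal)
        (maximalIdeal (Localization.AtPrime 𝔫.asIdeal)))) :
    (∀ i : Fin n, {𝔫 : PrimeSpectrum (blowupAlgebra J (x i)) |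
      𝔳.map (algebraMap T (blowupAlgebra J (x i))) ≤ 𝔫.asIdeal ∧
        ¬ IsRegularLocalRing (Localization.AtPrime 𝔫.asIdeal)}.Finite) ∧
    (∀ (i : Fin n) (𝔫 : PrimeSpectrum (blowupAlgebra J (x i))),
      𝔳.map (algebraMap T (blowupAlgebra J (x i))) ≤ 𝔫.asIdeal →
      ¬ IsRegularLocalRing (Localization.AtPrime 𝔫.asIdeal) →
      Scheme.IsRegular (affineBlowup (R := Localization.AtPrime 𝔫.asIdeal)
        (maximalIdeal (Localization.AtPrime 𝔫.asIdeal)))) :=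
  ⟨fun i => finite_nonRegular_over_of_reduction J 𝔳 y hyJ hred hfinm (x i) (hxJ i),
    fun i 𝔫 h𝔫𝔳 h𝔫 => isRegular_pointBlowup_of_reduction J 𝔳 y hyJ hred hmodel (x i) (hxJ i) 𝔫 h𝔫𝔳 h𝔫⟩

end Summit.ResolutionOfSingularities.ResolutionOfSingularities.Theorems.FRationalResolution.ChartFactsOfReduction

end
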